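import Summits.CriticalPhenomena.PercolationContinuityZ3.Theorems.Transplant.SkelRootSeedLawF
import Summits.CriticalPhenomena.PercolationContinuityZ3.Theorems.Transplant.SkelPhiWinChainFF3
import HarnessLib

/-!
# N2 (frames-only node `SamePDropOfSkeletonFrm₁`, OPEN), (R) column after J16/(R-38): **THE THREE-WINDOW ROOT ASSEMBLY UNDER THE ROOT-SEED LAW OVER
# (S0) KITS** — `Skel.rootChainF_of_chain₃`, the three-segment twin of `Skel.rootChainF_of_chain₂` (SkelRootChainWF p351917 ✓) for the SECOND-AXIS root leg
# of record: HOP → BRIDGE (window 1) → x-PREFIX corridor (window 2) → y′-corridor (window 3), N1's B.17 architecture (`rootOblTWAt_of_bridgeG3`)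

Why three windows (J16, design owner 2026-08-23; N1's (L-R4)): started next to the bridge landing, the y′-corridor's low regions contain the seed's row range
and drift across by `v` per hop, so they cannot clear the pinned seed in x; an x-prefix of `Nx ≈ 8–10` widths moves the chain out first (p5-g16 sieve).
Same hypotheses as the two-window assembly per segment (regions inside the cut root world `U'` and off the pinned seed `A`, nonempty true targets, counts,
per-level forced-kit clauses and rim excesses under `S.W0pin G (edgesIn G A) U'`), two cross links, the hop into the first level, the last true target
inside `M_{a₀}(0 + du)`; the chain is `WinChainData.chainF₃` (SkelPhiWinChainFF3).  Conclusion: the `RootOblTWF` body at `du`, length `S₁.N + 1 + S₂.N + 1 + S₃.N`.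
-- non-vacuity: discharged jointly by the (R) second-axis skeleton `NegB.rootLegAt_frmQ3D_snd` at stmt-g20's values (prefix `kgCorrSched … Nx`, `Nx ≈ 8–10`,
-- y′-corridor `kgCorrSchedY …`; p5-g16's `kgCorrSchedY_region_bounds` for the 2-D clearance) — pending; N1 discharged the `{±1}` twin (SkelPhiRootNumbersY6).
builds on p205010 (kernel theorem, internal audit signed; external expert review pending) — nothing in this file uses p205010; nothing here is a claim about
the open node `SamePDropOfSkeletonFrm₁`.
Lane `prim-bschramm`, seat `prim-bschramm-p3` (gen 16; N2 design owner, (R) column owner); helper file (`--supports stmt-CriticalPhenomena-4575 --as helper`).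
[cite: KozmaNitzan2024, §4 p. 28 ((32) at the root), Lemma 11 (pp. 22–23), Lemma 12 (pp. 23–25)] [cite: MartineauTassion2017, §4.3 Lemma 4.2]
-/

noncomputable section

open MeasureTheory ProbabilityTheory
open scoped ENNReal Classical

namespace Summit.CriticalPhenomena.PercolationContinuityZ3.Theorems

namespace Transplant

namespace Skel

open Literature.Probability.Percolation Literature.Probability.LatticeModels SimpleGraph GadgetSystem ProbeHistory HSiteScheme Contour KNCells
open KNCells.KSchA KNLevels ChainPlanar
open Literature.Barriers.CriticalPhenomena (graphBall mem_graphBall_self)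

variable {V : Type} [DecidableEq V] [Countable V] (G : SimpleGraph V) [G.LocallyFinite] {A' : Type*}

/-! ## §1 The root obligation at one direction -/

variable {G}

/-- **THE ROOT LEG OF ONE DIRECTION FROM A THREE-WINDOW CHAIN UNDER THE ROOT-SEED LAW, (S0) KITS, `RootOblTWF` SHAPE** (see the module docstring):
segment 1 = the bridge frame, segment 2 = the x-prefix corridor, segment 3 = the y′-corridor, each through its own planar window of `winGraph G root Rπ`;
cross links `hx`, `hx₂`; conclusion = the `RootOblTWF` body at `du`, length `S₁.N + 1 + S₂.N + 1 + S₃.N`.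
[cite: KozmaNitzan2024, §4 p. 28 ((32) at the root), Lemma 11 (pp. 22–23), Lemma 12 (pp. 23–25)] -/
theorem rootChainF_of_chain₃ {S : KSchA V A'} {du : MDir} {Rπ : ℕ}
    -- the pinned seed (inside the root cube and the ball, containing the root, internally connected)
    {A : Finset V} (hAQ : A ⊆ S.Γ.Q S.Γ.a₀ 0) (hAπ : ∀ a ∈ A, a ∈ graphBall G S.Γ.root Rπ) (htA : S.Γ.root ∈ A)
    (hAconn : ∀ a ∈ A, PathIn G (↑A : Set V) S.Γ.root a)
    -- three windows of the root's ball window graph, three frames, chain data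
    (𝒲₁ 𝒲₂ 𝒲₃ : Skelφ.PlanarWindow (winGraph G S.Γ.root Rπ)) (S₁ S₂ S₃ : SchedFrame) (P₁ P₂ P₃ : Skelφ.WinChainData V)
    (hPo₁ : P₁.o = S.Γ.root) (hPo₂ : P₂.o = S.Γ.root) (hPo₃ : P₃.o = S.Γ.root)
    (hPS₁ : P₁.Sfin = (S.U0root du).filter fun y => y ∈ graphBall G S.Γ.root Rπ)
    (hPS₂ : P₂.Sfin = (S.U0root du).filter fun y => y ∈ graphBall G S.Γ.root Rπ)
    (hPS₃ : P₃.Sfin = (S.U0root du).filter fun y => y ∈ graphBall G S.Γ.root Rπ)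
    (hRim₁ : ∀ k, P₁.Rim k ⊆ 𝒲₁.stepDF S₁ k) (hRim₂ : ∀ k, P₂.Rim k ⊆ 𝒲₂.stepDF S₂ k) (hRim₃ : ∀ k, P₃.Rim k ⊆ 𝒲₃.stepDF S₃ k)
    (hRl₁ : P₁.Rlev + 1 ≤ S₁.R') (hRl₂ : P₂.Rlev + 1 ≤ S₂.R') (hRl₃ : P₃.Rlev + 1 ≤ S₃.R')
    (hj₁ : P₁.j₁ ≤ P₁.Rlev) (hj₂ : P₂.j₁ ≤ P₂.Rlev) (hj₃ : P₃.j₁ ≤ P₃.Rlev)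
    (hTne₁ : ∀ k ≤ S₁.N, (𝒲₁.coreTF S₁ k).Nonempty) (hTne₂ : ∀ k ≤ S₂.N, (𝒲₂.coreTF S₂ k).Nonempty)
    (hTne₃ : ∀ k ≤ S₃.N, (𝒲₃.coreTF S₃ k).Nonempty)
    -- the rooms: regions inside the cut root world, off the pinned seed; the cross link; the last core inside `M_{a₀}(0+du)`
    (hDU₁ : ∀ k ≤ S₁.N, 𝒲₁.stepDF S₁ k ⊆ (S.U0root du).filter fun y => y ∈ graphBall G S.Γ.root Rπ)
    (hDU₂ : ∀ k ≤ S₂.N, 𝒲₂.stepDF S₂ k ⊆ (S.U0root du).filter fun y => y ∈ graphBall G S.Γ.root Rπ)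
    (hDU₃ : ∀ k ≤ S₃.N, 𝒲₃.stepDF S₃ k ⊆ (S.U0root du).filter fun y => y ∈ graphBall G S.Γ.root Rπ)
    (hDA₁ : ∀ k ≤ S₁.N, Disjoint (𝒲₁.stepDF S₁ k) A) (hDA₂ : ∀ k ≤ S₂.N, Disjoint (𝒲₂.stepDF S₂ k) A)
    (hDA₃ : ∀ k ≤ S₃.N, Disjoint (𝒲₃.stepDF S₃ k) A)
    (hx : 𝒲₁.coreTF S₁ S₁.N ⊆ 𝒲₂.W (S₂.core 0)) (hx₂ : 𝒲₂.coreTF S₂ S₂.N ⊆ 𝒲₃.W (S₃.core 0))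
    (hlast : 𝒲₃.coreTF S₃ S₃.N ⊆ S.Γ.M S.Γ.a₀ ((0 : Site 2) + stepVec du))
    -- the hop: ONE link input valid for `P_q`, prism inside the world, target inside the first level
    {Δ' : ℕ} {δ : ℝ} {η : ℝ} {Qp T₀ : Finset V}
    (hlink : 1 - δ < (bondPercolation G S.p).real (linkIn (↑Qp : Set V) A T₀))
    (hQU : Qp ⊆ (S.U0root du).filter fun y => y ∈ graphBall G S.Γ.root Rπ) (hT₀ : T₀ ⊆ 𝒲₁.W (S₁.core 0))
    -- analytic inputs under the root-seed law, accuracy `δ` (forced-kit clause shape)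
    (hcount₁ : 1 / (1 - (S.p : ℝ)) ^ (Δ' * P₁.N) ≤ δ * ((Finset.Icc P₁.j₀ P₁.j₁).card : ℝ))
    (hcount₂ : 1 / (1 - (S.p : ℝ)) ^ (Δ' * P₂.N) ≤ δ * ((Finset.Icc P₂.j₀ P₂.j₁).card : ℝ))
    (hcount₃ : 1 / (1 - (S.p : ℝ)) ^ (Δ' * P₃.N) ≤ δ * ((Finset.Icc P₃.j₀ P₃.j₁).card : ℝ))
    (hkits₁ : ∀ k ≤ S₁.N, ∀ j ∈ Finset.Icc P₁.j₀ P₁.j₁, ∃ (σ : SData V) (Sz : Finset V),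
      SHyp (P₁.stepLF 𝒲₁ S₁ k) j σ ∧ σ.N ≤ P₁.N ∧ (1 - (S.p : ℝ) ^ σ.sB) ^ σ.k ≤ δ ∧ Sz ⊆ 𝒲₁.stepDF S₁ k ∧ (∀ x ∈ σ.K, σ.face x ⊆ Sz) ∧
      RelayClause (P₁.stepLF 𝒲₁ S₁ k) (S.W0pin G (edgesIn G A) ((S.U0root du).filter fun y => y ∈ graphBall G S.Γ.root Rπ)) j σ Sz
        (P₁.coreEF 𝒲₁ S₁ k) (𝒲₁.stepDF S₁ k) δ)
    (hkits₂ : ∀ k ≤ S₂.N, ∀ j ∈ Finset.Icc P₂.j₀ P₂.j₁, ∃ (σ : SData V) (Sz : Finset V),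
      SHyp (P₂.stepLF 𝒲₂ S₂ k) j σ ∧ σ.N ≤ P₂.N ∧ (1 - (S.p : ℝ) ^ σ.sB) ^ σ.k ≤ δ ∧ Sz ⊆ 𝒲₂.stepDF S₂ k ∧ (∀ x ∈ σ.K, σ.face x ⊆ Sz) ∧
      RelayClause (P₂.stepLF 𝒲₂ S₂ k) (S.W0pin G (edgesIn G A) ((S.U0root du).filter fun y => y ∈ graphBall G S.Γ.root Rπ)) j σ Sz
        (P₂.coreEF 𝒲₂ S₂ k) (𝒲₂.stepDF S₂ k) δ)
    (hkits₃ : ∀ k ≤ S₃.N, ∀ j ∈ Finset.Icc P₃.j₀ P₃.j₁, ∃ (σ : SData V) (Sz : Finset V),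
      SHyp (P₃.stepLF 𝒲₃ S₃ k) j σ ∧ σ.N ≤ P₃.N ∧ (1 - (S.p : ℝ) ^ σ.sB) ^ σ.k ≤ δ ∧ Sz ⊆ 𝒲₃.stepDF S₃ k ∧ (∀ x ∈ σ.K, σ.face x ⊆ Sz) ∧
      RelayClause (P₃.stepLF 𝒲₃ S₃ k) (S.W0pin G (edgesIn G A) ((S.U0root du).filter fun y => y ∈ graphBall G S.Γ.root Rπ)) j σ Sz
        (P₃.coreEF 𝒲₃ S₃ k) (𝒲₃.stepDF S₃ k) δ)
    (hη : η ≤ δ / 2)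
    (hexc₁ : ∀ k ≤ S₁.N, (prodBernoulli (S.W0pin G (edgesIn G A) ((S.U0root du).filter fun y => y ∈ graphBall G S.Γ.root Rπ))).real
      (⋃ t' ∈ P₁.Rim k, openConn S.Γ.root t') ≤ η)
    (hexc₂ : ∀ k ≤ S₂.N, (prodBernoulli (S.W0pin G (edgesIn G A) ((S.U0root du).filter fun y => y ∈ graphBall G S.Γ.root Rπ))).real
      (⋃ t' ∈ P₂.Rim k, openConn S.Γ.root t') ≤ η)
    (hexc₃ : ∀ k ≤ S₃.N, (prodBernoulli (S.W0pin G (edgesIn G A) ((S.U0root du).filter fun y => y ∈ graphBall G S.Γ.root Rπ))).real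
      (⋃ t' ∈ P₃.Rim k, openConn S.Γ.root t') ≤ η) :
    ∃ (c : V) (R₀ : ℕ) (W : Sym2 V → unitInterval) (s : Fin (S₁.N + 1 + S₂.N + 1 + S₃.N + 1) → KNLevels.TStep (winGraph G c R₀))
      (T' : Fin (S₁.N + 1 + S₂.N + 1 + S₃.N + 1) → Finset V) (η' : ℝ),
      (∀ T : Finset V, (prodBernoulli W).real (⋃ t ∈ T, openConn S.Γ.root t) ≤
        (prodBernoulli (pinW (KNLevels.lattW G S.p) ↑(S.U₀ G) ↑(S.U₀ G))).real
          (⋃ t ∈ (↑T : Set V), openConnIn (↑(S.Γ.Q S.Γ.a₀ 0 ∪ S.Γ.Ewv S.Γ.a₀ 0 du) : Set V) S.Γ.root t)) ∧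
      (∀ i : Fin (S₁.N + 1 + S₂.N + 1 + S₃.N + 1), (s i).L.o = S.Γ.root) ∧
      (∀ i : Fin (S₁.N + 1 + S₂.N + 1 + S₃.N), T' (Fin.castSucc i) ⊆ (s i.succ).L.X 0) ∧ (∀ i : Fin (S₁.N + 1 + S₂.N + 1 + S₃.N + 1), T' i ⊆ (s i).T) ∧
      (∀ i : Fin (S₁.N + 1 + S₂.N + 1 + S₃.N + 1), (s i).KitsAtF W S.p Δ' δ) ∧ η' ≤ δ / 2 ∧
      (∀ i : Fin (S₁.N + 1 + S₂.N + 1 + S₃.N + 1), (prodBernoulli W).real (⋃ t ∈ (s i).T \ T' i, openConn S.Γ.root t) ≤ η') ∧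
      1 - δ < (prodBernoulli W).real (s 0).L.reachB ∧
      T' (Fin.last (S₁.N + 1 + S₂.N + 1 + S₃.N)) ⊆ S.Γ.M S.Γ.a₀ ((0 : Site 2) + stepVec du) := by
  set U' : Finset V := (S.U0root du).filter fun y => y ∈ graphBall G S.Γ.root Rπ with hU'
  set F : Finset (Sym2 V) := edgesIn G A with hF
  set W : Sym2 V → unitInterval := S.W0pin G F U' with hW
  set n : ℕ := S₁.N + 1 + S₂.N + 1 + S₃.N with hn
  -- the seed: its pairs are cube edges, its vertices lie in the cut world
  have hFA : ∀ e ∈ F, ∀ w ∈ e, w ∈ A := fun e he w hw => ((mem_edgesIn_iff).1 he).2 w hw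
  have hFU₀ : F ⊆ S.U₀ G := by
    intro e he
    rw [KSchA.U₀, mem_edgesIn_iff]
    obtain ⟨heG, heA⟩ := (mem_edgesIn_iff).1 he
    exact ⟨heG, fun x hx => hAQ (heA x hx)⟩
  have hAU : A ⊆ U' := fun a ha => Finset.mem_filter.2 ⟨Finset.mem_union_left _ (hAQ ha), hAπ a ha⟩
  have hrootU : S.Γ.root ∈ U' := hAU htA
  have hU'sub : U' ⊆ S.U0root du := Finset.filter_subset _ _
  -- subbox regions (off the seed), the source off the regions
  have hfresh : ∀ {Dd : Finset V}, Disjoint Dd A → ∀ u ∈ Dd, ∀ z, s(u, z) ∉ F := fun hdis => KSchA.fresh_of_disjoint hFA hdis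
  have hsub₁ : ∀ k ≤ S₁.N, IsSubbox (winGraph G S.Γ.root Rπ) W S.p (𝒲₁.stepDF S₁ k) :=
    fun k hk => isSubbox_W0pin_win (S := S) S.Γ.root Rπ (U := S.U0root du) (hDU₁ k hk) (hfresh (hDA₁ k hk))
  have hsub₂ : ∀ k ≤ S₂.N, IsSubbox (winGraph G S.Γ.root Rπ) W S.p (𝒲₂.stepDF S₂ k) :=
    fun k hk => isSubbox_W0pin_win (S := S) S.Γ.root Rπ (U := S.U0root du) (hDU₂ k hk) (hfresh (hDA₂ k hk))
  have ho₁ : ∀ k ≤ S₁.N, P₁.o ∉ 𝒲₁.stepDF S₁ k := fun k hk h' => by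
    rw [hPo₁] at h'; exact Finset.disjoint_left.1 (hDA₁ k hk) h' htA
  have ho₂ : ∀ k ≤ S₂.N, P₂.o ∉ 𝒲₂.stepDF S₂ k := fun k hk h' => by
    rw [hPo₂] at h'; exact Finset.disjoint_left.1 (hDA₂ k hk) h' htA
  have hsub₃ : ∀ k ≤ S₃.N, IsSubbox (winGraph G S.Γ.root Rπ) W S.p (𝒲₃.stepDF S₃ k) :=
    fun k hk => isSubbox_W0pin_win (S := S) S.Γ.root Rπ (U := S.U0root du) (hDU₃ k hk) (hfresh (hDA₃ k hk))
  have ho₃ : ∀ k ≤ S₃.N, P₃.o ∉ 𝒲₃.stepDF S₃ k := fun k hk h' => by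
    rw [hPo₃] at h'; exact Finset.disjoint_left.1 (hDA₃ k hk) h' htA
  -- the three-window chain
  have hC := Skelφ.WinChainData.chainF₃ P₁ P₂ 𝒲₁ 𝒲₂ S₁ S₂ (hPo₂.trans hPo₁.symm) hRl₁ hRim₁ hTne₁ hRl₂ hRim₂ hTne₂ hx
    (p := S.p) (W' := W) (Δ' := Δ') (δ := δ) (η := η)
    hsub₁ (by rw [hPS₁]; exact KSchA.finSupp_W0pin) (fun k hk => by rw [hPS₁]; exact hDU₁ k hk) ho₁ (by rw [hPo₁, hPS₁]; exact hrootU) hj₁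
    hcount₁ hkits₁ (fun k hk => by rw [hPo₁]; exact hexc₁ k hk)
    hsub₂ (by rw [hPS₂]; exact KSchA.finSupp_W0pin) (fun k hk => by rw [hPS₂]; exact hDU₂ k hk) ho₂ (by rw [hPo₂, hPS₂]; exact hrootU) hj₂
    hcount₂ hkits₂ (fun k hk => by rw [hPo₁]; exact hexc₂ k hk)
    P₃ 𝒲₃ S₃ (hPo₃.trans hPo₁.symm) hRl₃ hRim₃ hTne₃ hx₂
    hsub₃ (by rw [hPS₃]; exact KSchA.finSupp_W0pin) (fun k hk => by rw [hPS₃]; exact hDU₃ k hk) ho₃ (by rw [hPo₃, hPS₃]; exact hrootU) hj₃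
    hcount₃ hkits₃ (fun k hk => by rw [hPo₁]; exact hexc₃ k hk)
  obtain ⟨ho, hlinkC, hsubC, hkitsC, hexcC, h0, hlastC⟩ := hC
  -- the hop under the root-seed law
  have hwired : ∀ u ∈ A, ∀ u' ∈ A, G.Adj u u' → s(u, u') ∈ F := fun u hu u' hu' hadj =>
    (mem_edgesIn_iff).2 ⟨(SimpleGraph.mem_edgeSet G).2 hadj, fun x hx => by
      rcases Sym2.mem_iff.1 hx with rfl | rfl
      · exact hu
      · exact hu'⟩
  have hsrc : 1 - δ < (prodBernoulli W).real (⋃ t' ∈ T₀, openConn S.Γ.root t') :=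
    root_hsrc_of_pinned (S := S) hlink hQU hAU subset_rfl hAconn hwired
  refine ⟨S.Γ.root, Rπ, W, fun i => pw (S₁.N + 1 + S₂.N) (Skelφ.WinChainData.stepAF₂ P₁ P₂ 𝒲₁ 𝒲₂ S₁ S₂) (fun k => P₃.stepAF 𝒲₃ S₃ k) i, fun i => pw (S₁.N + 1 + S₂.N) (Skelφ.WinChainData.coreTF₂ 𝒲₁ 𝒲₂ S₁ S₂) (fun k => 𝒲₃.coreTF S₃ k) i, η,
    fun T => KSchA.real_W0pin_le_rootLaw hFU₀ hU'sub hrootU T, fun i => (ho i).trans hPo₁, hlinkC, hsubC, hkitsC, hη,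
    fun i => by have h := hexcC i; rw [hPo₁] at h; exact h, ?_, ?_⟩
  · -- the source bound: `T₀ ⊆ X^{(0)}_0 = 𝒲₁.W (S₁.core 0)`
    refine hsrc.trans_le (measureReal_mono ?_ (measure_ne_top _ _))
    intro ω hω
    simp only [Set.mem_iUnion, exists_prop] at hω
    obtain ⟨t', ht', hωt⟩ := hω
    have ht'' : t' ∈ (pw (S₁.N + 1 + S₂.N) (Skelφ.WinChainData.stepAF₂ P₁ P₂ 𝒲₁ 𝒲₂ S₁ S₂) (fun k => P₃.stepAF 𝒲₃ S₃ k) ((0 : Fin (n + 1)) : ℕ)).L.X 0 := by rw [h0]; exact hT₀ ht'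
    have hoo : (pw (S₁.N + 1 + S₂.N) (Skelφ.WinChainData.stepAF₂ P₁ P₂ 𝒲₁ 𝒲₂ S₁ S₂) (fun k => P₃.stepAF 𝒲₃ S₃ k) ((0 : Fin (n + 1)) : ℕ)).L.o = S.Γ.root := (ho 0).trans hPo₁
    show ω ∈ (pw (S₁.N + 1 + S₂.N) (Skelφ.WinChainData.stepAF₂ P₁ P₂ 𝒲₁ 𝒲₂ S₁ S₂) (fun k => P₃.stepAF 𝒲₃ S₃ k) ((0 : Fin (n + 1)) : ℕ)).L.reachB
    rw [LData.reachB, hoo]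
    exact Set.mem_biUnion (Finset.mem_coe.2 ht'') hωt
  · -- the last true target enters `M_{a₀}(0 + du)`
    rw [hlastC]; exact hlast

end Skel

end Transplant

end Summit.CriticalPhenomena.PercolationContinuityZ3.Theorems

end
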